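import Literature.Geometry.Lorentzian.SpacetimeLocalConvergenceOfCharts
import HarnessLib

/-!
# The datum defined by converging charts carries its charts as converging far charts

For the subconvergence datum `LocalSubconvergence.ofCharts` (`SpacetimeLocalConvergenceOfCharts.lean`:
charts `Ψₙ : B.domain → 𝓢ₙ` on the domain of a model background `B`, converging components, limit
the near-Minkowski chart spacetime `(B.domain, G, ∂₀)`) the clause
`LocalSubconvergence.FarChartsConverge` (`SpacetimeLocalConvergence.lean`) holds with far charts
THE CHARTS THEMSELVES `Φₙ := Ψₙ` and limit far chart `Φ := id`, for ANY reference form `B.bilin`: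
(i) the comparison maps are the charts, so `embed m ∘ id = Ψ_{φ m}` identically; (ii) the
difference of the deviations `(Ψ_{φ m}^* g − g₀) − (G − g₀) = Ψ_{φ m}^* g − G` does not see the
background and converges to `0` in `Cᵏ` on compacts by hypothesis. Hence
`SubconvergesLocallyWithFarChartsTo 𝓢ₙ pₙ (L.spacetime _) y₀ k B Ψ id`
(`SubconvergesLocallyWithFarChartsTo.ofCharts`) — the convergence notion of the ω-limit clauses
(`ArisesFrom`) of the tame final-state routes, when the charts live on an eternal far zone
`B = farBackground M R`.

## References
* P. Petersen, *Riemannian Geometry*, 2nd ed., GTM 171, Springer 2006, Ch. 10, §3.2. [Petersen2006]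
* M. T. Anderson, Cheeger–Gromov theory and applications to general relativity, 2004, Def. 1.1. [Anderson2004]
-/

noncomputable section

open Set Filter TopologicalSpace Function
open scoped Manifold ContDiff Topology ENNReal

universe u

namespace Literature.Geometry.Lorentzian

namespace NearMinkowskiChart

variable (B : ModelBackground) (L : NearMinkowskiChart B.domain)
  (hO : IsConnected (B.domain : Set E4))

/-- **The deviation of the identity chart of `(B.domain, G, ∂₀)` from the background is `G − g₀`.**
[folklore] -/
theorem deviation_id_background (x : B.domain) :
    (L.spacetime hO).deviation B (id : B.domain → (L.spacetime hO).carrier) x = L.G x - B.bilin x := by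
  ext v w
  have hid : mfderiv 𝓘(ℝ, E4) (𝓡 4) (id : B.domain → (L.spacetime hO).carrier) x =
      ContinuousLinearMap.id ℝ E4 := mfderiv_id
  show (L.spacetime hO).metric.val x
      (mfderiv 𝓘(ℝ, E4) (𝓡 4) (id : B.domain → (L.spacetime hO).carrier) x v)
      (mfderiv 𝓘(ℝ, E4) (𝓡 4) (id : B.domain → (L.spacetime hO).carrier) x w) - B.bilin x v w =
    L.G x v w - B.bilin x v w
  rw [hid]
  rfl

/-- The extended deviation of the identity chart is `G − g₀` on the domain. [folklore] -/
theorem deviationExtend_id_background_of_mem {y : E4} (hy : y ∈ (B.domain : Set E4)) :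
    (L.spacetime hO).deviationExtend B (id : B.domain → (L.spacetime hO).carrier) y =
      L.G y - B.bilin y :=
  ((L.spacetime hO).deviationExtend_coe B (id : B.domain → (L.spacetime hO).carrier) ⟨y, hy⟩).trans
    (L.deviation_id_background B hO ⟨y, hy⟩)

end NearMinkowskiChart

namespace Spacetime

namespace LocalSubconvergence

variable {𝓢ₙ : ℕ → Spacetime.{u} 4} {pₙ : ∀ n, (𝓢ₙ n).carrier}

/-- **The charts of `ofCharts` converge as far charts, for any reference form** (module
docstring). [cite: Anderson2004, Def. 1.1] -/
theorem farChartsConverge_ofCharts (B : ModelBackground) (hO : IsConnected (B.domain : Set E4))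
    {y₀ : E4} (hy₀ : y₀ ∈ (B.domain : Set E4)) (Ψ : ∀ n, B.domain → (𝓢ₙ n).carrier)
    (hΨ : ∀ n, ContMDiff 𝓘(ℝ, E4) (𝓡 4) ∞ (Ψ n)) (hinj : ∀ n, Injective (Ψ n))
    (hcentre : ∀ n, Ψ n ⟨y₀, hy₀⟩ = pₙ n)
    (hfut : ∀ n, (𝓢ₙ n).timeOrientation.IsFutureDirected
      (mfderiv 𝓘(ℝ, E4) (𝓡 4) (Ψ n) ⟨y₀, hy₀⟩ (E4.basisVector 0)))
    (hpinch : ∀ n, ∀ y ∈ (B.domain : Set E4),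
      ‖(𝓢ₙ n).deviationExtend (Minkowski.backgroundOn B.domain) (Ψ n) y‖ < 1)
    (L : NearMinkowskiChart B.domain) {φ : ℕ → ℕ} (hφ : StrictMono φ) (k : ℕ)
    (hlim : ∀ K ⊆ (B.domain : Set E4), IsCompact K →
      Tendsto (fun m ↦ supCkENorm K k
        ((𝓢ₙ (φ m)).metricInCoords (Ψ (φ m) ∘ (chartAt E4 (⟨y₀, hy₀⟩ : B.domain)).symm) - L.G))
        atTop (𝓝 0)) :
    (ofCharts hO hy₀ Ψ hΨ hinj hcentre hfut hpinch L hφ k hlim).FarChartsConverge B Ψ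
      (id : B.domain → (L.spacetime hO).carrier) where
  eventually_embed_comp_eq _ _ _ := Eventually.of_forall fun _ _ _ ↦ rfl
  tendsto_supCkENorm_deviationExtend K hK hKO := by
    refine (hlim K hKO hK).congr fun m ↦ supCkENorm_congr fun y hy ↦ ?_
    filter_upwards [B.domain.2.mem_nhds (hKO hy)] with z hz
    have h1 := (𝓢ₙ (φ m)).metricInCoords_comp_chartAt_symm_sub_eq_deviation B (Ψ (φ m))
      ⟨y₀, hy₀⟩ hz (((hΨ (φ m)) ⟨z, hz⟩).mdifferentiableAt (by simp))
    have h2 : (𝓢ₙ (φ m)).deviationExtend B (Ψ (φ m)) z = (𝓢ₙ (φ m)).deviation B (Ψ (φ m)) ⟨z, hz⟩ :=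
      (𝓢ₙ (φ m)).deviationExtend_coe B (Ψ (φ m)) ⟨z, hz⟩
    have h3 := L.deviationExtend_id_background_of_mem B hO hz
    show (𝓢ₙ (φ m)).metricInCoords (Ψ (φ m) ∘ (chartAt E4 (⟨y₀, hy₀⟩ : B.domain)).symm) z - L.G z =
      (𝓢ₙ (φ m)).deviationExtend B (Ψ (φ m)) z -
        (L.spacetime hO).deviationExtend B (id : B.domain → (L.spacetime hO).carrier) z
    rw [h2, ← h1, h3]
    ext v w
    simp only [sub_apply]
    ring

end LocalSubconvergence

/-- **Subconvergence with far charts from converging charts**: under the hypotheses of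
`SubconvergesLocallyTo.ofCharts`, `(𝓢ₙ, pₙ)` subconverges to `(B.domain, G, ∂₀)` WITH FAR CHARTS
`Ψₙ → id` for any reference background `B` on the chart domain. [cite: Anderson2004, Def. 1.1] -/
theorem SubconvergesLocallyWithFarChartsTo.ofCharts {𝓢ₙ : ℕ → Spacetime.{u} 4}
    {pₙ : ∀ n, (𝓢ₙ n).carrier} (B : ModelBackground) (hO : IsConnected (B.domain : Set E4))
    {y₀ : E4} (hy₀ : y₀ ∈ (B.domain : Set E4)) (Ψ : ∀ n, B.domain → (𝓢ₙ n).carrier)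
    (hΨ : ∀ n, ContMDiff 𝓘(ℝ, E4) (𝓡 4) ∞ (Ψ n)) (hinj : ∀ n, Injective (Ψ n))
    (hcentre : ∀ n, Ψ n ⟨y₀, hy₀⟩ = pₙ n)
    (hfut : ∀ n, (𝓢ₙ n).timeOrientation.IsFutureDirected
      (mfderiv 𝓘(ℝ, E4) (𝓡 4) (Ψ n) ⟨y₀, hy₀⟩ (E4.basisVector 0)))
    (hpinch : ∀ n, ∀ y ∈ (B.domain : Set E4),
      ‖(𝓢ₙ n).deviationExtend (Minkowski.backgroundOn B.domain) (Ψ n) y‖ < 1)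
    (L : NearMinkowskiChart B.domain) {φ : ℕ → ℕ} (hφ : StrictMono φ) {k : ℕ}
    (hlim : ∀ K ⊆ (B.domain : Set E4), IsCompact K →
      Tendsto (fun m ↦ supCkENorm K k
        ((𝓢ₙ (φ m)).metricInCoords (Ψ (φ m) ∘ (chartAt E4 (⟨y₀, hy₀⟩ : B.domain)).symm) - L.G))
        atTop (𝓝 0)) :
    SubconvergesLocallyWithFarChartsTo 𝓢ₙ pₙ (L.spacetime hO) ⟨y₀, hy₀⟩ k B Ψ
      (id : B.domain → (L.spacetime hO).carrier) :=
  ⟨LocalSubconvergence.ofCharts hO hy₀ Ψ hΨ hinj hcentre hfut hpinch L hφ k hlim,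
    LocalSubconvergence.farChartsConverge_ofCharts B hO hy₀ Ψ hΨ hinj hcentre hfut hpinch L hφ k hlim⟩

end Spacetime

end Literature.Geometry.Lorentzian

end
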